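import Summits.AnomalousDissipation.AnomalousDissipation.Theorems.SolenoidalFractalHomogenisationRealisedQuasiStaticCellLawSlavedIsoSectorDecayAE
import Summits.AnomalousDissipation.AnomalousDissipation.Theorems.SolenoidalFractalHomogenisationRealisedQuasiStaticCellLawComovingPairWeights
import Summits.AnomalousDissipation.AnomalousDissipation.Theorems.SolenoidalFractalHomogenisationRealisedQuasiStaticCellLawComovingJunctionFrames
import Summits.AnomalousDissipation.AnomalousDissipation.Theorems.SolenoidalFractalHomogenisationRealisedQuasiStaticCellLawComovingStartEndFrames
import Summits.AnomalousDissipation.AnomalousDissipation.Theorems.SolenoidalFractalHomogenisationRealisedQuasiStaticCellLawComovingNearCommuting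
import Summits.AnomalousDissipation.AnomalousDissipation.Theorems.SolenoidalFractalHomogenisationRealisedQuasiStaticCellLawComovingCSeq
import Summits.AnomalousDissipation.AnomalousDissipation.Theorems.SolenoidalFractalHomogenisationRealisedQuasiStaticCellLawRateChoice
import HarnessLib

/-!
# K2R `RealisedQuasiStaticCellLaw`, line `floquet-bloch`, stub `stub_lowSectorWeakNear`: the co-moving road assembled —
# `isoSector_decay_ae` with the co-moving weights, junction/start/end and slot factors discharged
# (helper; `--supports stmt-AnomalousDissipation-20446`)

Summits-side helper file (everything proved; no definitions, no named facts). `isoSector_decay_comoving`: given the frames of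
`isoSector_decay_ae` (p582517) and the slaving data `Λ, σ_o, σ_i, σ, g₁`, the co-moving weights of p584475 (transport
coefficients from `comoving_cseq_exists`, p592660; rotations `rc_j = ζ₀·ζ_j`, `rs_j = (k̂×ζ₀)·ζ_j`) satisfy `hwa/hwb/hwc`, `hG`
(`G_min = e^{−2λP}`, `comoving_hG`), `hGmax` (`G_max = e^{4ΣX}`, `comoving_hGmax`), `hjunc/hstart/hend` (p593449, p593644; the END
from the expansion hypothesis `e^{2λP} ≤ (1 + μ − S²)²` through `comoving_transport_lower`, p586227) and `hΘ` with
`Θ_j = e^{−2(1−2ε)λτ_j}` (junk `≤ 2ελτ_j`): every weak solution from the sector decays like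
`β e^{2(1−2ε)λP} e^{−2(1−2ε)λt}`. What is left for the cell level: the isotropy bound `μ` (`iso_mu_lower` + `iso_isotropy_sum_word`)
and scalar smallness.
-/

set_option linter.dupNamespace false

noncomputable section

namespace Summit.AnomalousDissipation.AnomalousDissipation.Theorems.SolenoidalFractalHomogenisation.RealisedQuasiStaticCellLaw

open Set MeasureTheory Filter Topology Function Complex Matrix
open scoped InnerProductSpace ComplexConjugate Matrix
open Literature.Analysis Literature.Analysis.FunctionSpaces Literature.Analysis.FunctionSpaces.Torus
open Literature.Analysis.FluidPDE Literature.Analysis.FluidPDE.LatticeShear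

variable {k₀ : ℕ}

set_option maxHeartbeats 1600000 in
/-- **The co-moving road, assembled** (frames given; weights, transport, junctions, slot factors discharged). -/
theorem isoSector_decay_comoving (W : LatticeWord k₀) {n : ℕ} (hn : 0 < n) {κ : ℝ} (hκ : 0 < κ)
    (ℓ : Fin 3 → ℤ) (hℓn : 2 * ‖latticeVec ℓ‖ ≤ n) {w₀ : UnitAddTorus (Fin 3) → EuclideanSpace ℝ (Fin 3)}
    (hw₀ : FunctionSpaces.Torus.MemSobolev 1 (FunctionSpaces.EuclideanSpace.complexify ∘ w₀))
    (hdiv : FunctionSpaces.Torus.IsWeaklyDivFree w₀) (hmean : FunctionSpaces.Torus.HasZeroMean w₀)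
    (hsupp : ∀ k : Fin 3 → ℤ, ¬ ((∃ z : Fin 3 → ℤ, k = ℓ + (n:ℤ) • z) ∨ (∃ z : Fin 3 → ℤ, k = -ℓ + (n:ℤ) • z)) →
      UnitAddTorus.mFourierCoeff (FunctionSpaces.EuclideanSpace.complexify ∘ w₀) k = 0)
    (hk : ∀ j : Fin k₀, ∀ J : ℤ, ℓ + J • (fun i => (W.phase j).m i * (n : ℤ)) ≠ 0)
    (hdisj : ∀ j : Fin k₀, ∀ J J' : ℤ,
      ℓ + J • (fun i => (W.phase j).m i * (n : ℤ)) ≠ -(ℓ + J' • (fun i => (W.phase j).m i * (n : ℤ))))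
    (ζr : Fin k₀ → Fin 3 → ℝ) (hζ1 : ∀ j, ζr j ⬝ᵥ ζr j = 1) (hζ0 : ∀ j, ζr j ⬝ᵥ (fun i => ((ℓ i : ℤ) : ℝ)) = 0)
    (hζK : ∀ j, ζr j ⬝ᵥ (fun i => (((fun i => (W.phase j).m i * (n : ℤ)) i : ℤ) : ℝ)) = 0)
    (pf : Fin k₀ → ℤ → Fin 3 → ℝ)
    (hp : ∀ j, ∀ J : ℤ, pf j J = (Real.sqrt ((fun i => (((ℓ + J • (fun i => (W.phase j).m i * (n : ℤ))) i : ℤ) : ℝ)) ⬝ᵥ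
        (fun i => (((ℓ + J • (fun i => (W.phase j).m i * (n : ℤ))) i : ℤ) : ℝ))))⁻¹ •
        (fun i => (((ℓ + J • (fun i => (W.phase j).m i * (n : ℤ))) i : ℤ) : ℝ)) ⨯₃ ζr j)
    (hs : ∀ j, ∀ J : ℤ, |pf j J ⬝ᵥ pf j (J + 1)| ≤ 1)
    (hℓ : ℓ ≠ 0)
    (Λ σo σi σ g₁ : Fin k₀ → ℝ) (Δ ε β lam μ : ℝ)
    (hΛ : ∀ j, Λ j = κ * (4 * Real.pi ^ 2 * freqNormSq (fun i => (W.phase j).m i * (n : ℤ))))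
    (hΔ0 : 0 < Δ) (hε : 0 ≤ ε) (hε2 : ε ≤ 1 / 2) (hβ : 1 ≤ β) (hlam : 0 ≤ lam)
    (hΛ0 : ∀ j, 0 ≤ Λ j) (hσo0 : ∀ j, 0 ≤ σo j) (hσi0 : ∀ j, 0 ≤ σi j)
    (hgap : ∀ j, ∀ J : ℤ, J ≠ 0 →
      freqNormSq ℓ / freqNormSq (fun i => (W.phase j).m i * (n : ℤ)) + Δ ≤
        freqNormSq (ℓ + J • (fun i => (W.phase j).m i * (n : ℤ))) / freqNormSq (fun i => (W.phase j).m i * (n : ℤ)))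
    (hσo : ∀ j, σo j = 1 / (freqNormSq (ℓ + (-1 : ℤ) • (fun i => (W.phase j).m i * (n : ℤ))) /
          freqNormSq (fun i => (W.phase j).m i * (n : ℤ)) - freqNormSq ℓ / freqNormSq (fun i => (W.phase j).m i * (n : ℤ))) +
        1 / (freqNormSq (ℓ + (1 : ℤ) • (fun i => (W.phase j).m i * (n : ℤ))) /
          freqNormSq (fun i => (W.phase j).m i * (n : ℤ)) - freqNormSq ℓ / freqNormSq (fun i => (W.phase j).m i * (n : ℤ))))
    (hσi : ∀ j, σi j = (pf j (-1) ⬝ᵥ pf j 0) ^ 2 / (freqNormSq (ℓ + (-1 : ℤ) • (fun i => (W.phase j).m i * (n : ℤ))) /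
          freqNormSq (fun i => (W.phase j).m i * (n : ℤ)) - freqNormSq ℓ / freqNormSq (fun i => (W.phase j).m i * (n : ℤ))) +
        (pf j 0 ⬝ᵥ pf j 1) ^ 2 / (freqNormSq (ℓ + (1 : ℤ) • (fun i => (W.phase j).m i * (n : ℤ))) /
          freqNormSq (fun i => (W.phase j).m i * (n : ℤ)) - freqNormSq ℓ / freqNormSq (fun i => (W.phase j).m i * (n : ℤ))))
    (hg₁ : ∀ j, g₁ j = 2 * Real.pi * (∑ i, (W.phase j).e i * (ℓ i : ℝ)) *
        ‖Complex.exp ((W.phase j).φ * Complex.I) *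
          (1 / (2 * ((2 * Real.pi * ‖latticeVec (W.phase j).m‖ : ℝ) : ℂ) * Complex.I))‖ * (1 / (n : ℝ)) / Λ j)
    (hσole : ∀ j, σo j ≤ σ j) (hσile : ∀ j, σi j ≤ σ j)
    (hβ' : ∀ j, 16 * Real.exp (4 * (∑ j : Fin k₀, ((Λ j * ((freqNormSq ℓ / freqNormSq (fun i => (W.phase j).m i * (n : ℤ))) * (W.phase j).τ + σo j * g₁ j ^ 2 * ((W.phase j).τ * (1 - 4 * W.ramp / 3)))) + (Λ j * ((freqNormSq ℓ / freqNormSq (fun i => (W.phase j).m i * (n : ℤ))) * (W.phase j).τ + σi j * g₁ j ^ 2 * ((W.phase j).τ * (1 - 4 * W.ramp / 3))))))) ^ 2 * g₁ j ^ 2 * Λ j * 2 ≤ Real.exp (-(2 * lam * W.period)) * ε * lam * β * Δ)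
    (hsmall : ∀ j, g₁ j ^ 2 * (4 * 2 / Δ) + 2 * lam / Λ j ≤ Δ)
    (hJ : ∀ j, (40 * β * 2 * Λ j * (W.phase j).τ * g₁ j ^ 4 * (1 + g₁ j ^ 2 * σ j ^ 2) / Δ ^ 3 +
        48 * β * 2 * g₁ j ^ 2 / (W.ramp * (W.phase j).τ * Λ j * Δ ^ 3)) / Real.exp (-(2 * lam * W.period)) ≤
      2 * ε * (lam * (W.phase j).τ))
    (hF : ∀ j, 2 * (1 - 2 * ε) * (lam * (W.phase j).τ) ≤ 8 * Real.pi ^ 2 * κ * ((n : ℝ) / 2) ^ 2 * (W.phase j).τ)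
    (hiso : ∀ z₁ z₂ : ℝ, μ * (z₁ ^ 2 + z₂ ^ 2) ≤
      ∑ j : Fin k₀, ((Λ j * ((freqNormSq ℓ / freqNormSq (fun i => (W.phase j).m i * (n : ℤ))) * (W.phase j).τ + σo j * g₁ j ^ 2 * ((W.phase j).τ * (1 - 4 * W.ramp / 3)))) * ((ζr ⟨0, W.pos⟩ ⬝ᵥ ζr j) * z₁ + ((((Real.sqrt ((fun i => ((ℓ i : ℤ) : ℝ)) ⬝ᵥ (fun i => ((ℓ i : ℤ) : ℝ))))⁻¹ • (fun i => ((ℓ i : ℤ) : ℝ))) ⨯₃ ζr ⟨0, W.pos⟩) ⬝ᵥ ζr j) * z₂) ^ 2 + (Λ j * ((freqNormSq ℓ / freqNormSq (fun i => (W.phase j).m i * (n : ℤ))) * (W.phase j).τ + σi j * g₁ j ^ 2 * ((W.phase j).τ * (1 - 4 * W.ramp / 3)))) * (-((((Real.sqrt ((fun i => ((ℓ i : ℤ) : ℝ)) ⬝ᵥ (fun i => ((ℓ i : ℤ) : ℝ))))⁻¹ • (fun i => ((ℓ i : ℤ) : ℝ))) ⨯₃ ζr ⟨0, W.pos⟩)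 ⬝ᵥ ζr j) * z₁ + (ζr ⟨0, W.pos⟩ ⬝ᵥ ζr j) * z₂) ^ 2))
    (hsmallX : (∑ j : Fin k₀, (Real.exp ((Λ j * ((freqNormSq ℓ / freqNormSq (fun i => (W.phase j).m i * (n : ℤ))) * (W.phase j).τ + σo j * g₁ j ^ 2 * ((W.phase j).τ * (1 - 4 * W.ramp / 3)))) + (Λ j * ((freqNormSq ℓ / freqNormSq (fun i => (W.phase j).m i * (n : ℤ))) * (W.phase j).τ + σi j * g₁ j ^ 2 * ((W.phase j).τ * (1 - 4 * W.ramp / 3))))) - 1)) ≤ 1) (hpos : 0 ≤ 1 + μ - (∑ j : Fin k₀, (Real.exp ((Λ j * ((freqNormSq ℓ / freqNormSq (fun i => (W.phase j).m i * (n : ℤ))) * (W.phase j).τ + σo j * g₁ j ^ 2 * ((W.phase j).τ * (1 - 4 * W.ramp / 3)))) + (Λ j * ((freqNormSq ℓ / freqNormSq (fun i => (W.phase j).m i * (n : ℤ))) * (W.phase j).τ + σi j * g₁ j ^ 2 * ((W.phase j).τ * (1 - 4 * W.ramp / 3))))) - 1)) ^ 2)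
    (hlamμ : Real.exp (2 * lam * W.period) ≤ (1 + μ - (∑ j : Fin k₀, (Real.exp ((Λ j * ((freqNormSq ℓ / freqNormSq (fun i => (W.phase j).m i * (n : ℤ))) * (W.phase j).τ + σo j * g₁ j ^ 2 * ((W.phase j).τ * (1 - 4 * W.ramp / 3)))) + (Λ j * ((freqNormSq ℓ / freqNormSq (fun i => (W.phase j).m i * (n : ℤ))) * (W.phase j).τ + σi j * g₁ j ^ 2 * ((W.phase j).τ * (1 - 4 * W.ramp / 3))))) - 1)) ^ 2) ^ 2)
    {T : ℝ} (hT : 0 < T) {w : ℝ → UnitAddTorus (Fin 3) → EuclideanSpace ℝ (Fin 3)}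
    (hw : Torus.IsWeakPassiveVectorOn 0 T κ (W.cell n) w₀ w) :
    ∀ᵐ t ∂(volume.restrict (Ioo 0 T)), ∫ x, ‖w t x‖ ^ 2 ≤
      β * Real.exp (2 * (1 - 2 * ε) * lam * W.period) * Real.exp (-(2 * (1 - 2 * ε) * lam) * t) * ∫ x, ‖w₀ x‖ ^ 2 := by
  classical
  have hP : 0 < W.period := by
    have : Nonempty (Fin k₀) := ⟨⟨0, W.pos⟩⟩
    exact Finset.sum_pos (fun j _ => (W.phase j).τ_pos) Finset.univ_nonempty
  have hρ := W.ramp_pos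
  have hr : 0 ≤ 1 - 4 * W.ramp / 3 := by linarith only [W.ramp_le]
  have hKpos : ∀ j : Fin k₀, 0 < freqNormSq (fun i => (W.phase j).m i * (n : ℤ)) := fun j => by
    rw [← norm_latticeVec_sq]; have := one_le_norm_latticeVec (cellFreq_ne_zero (W.phase j) hn); positivity
  have hd00 : ∀ j : Fin k₀, 0 ≤ (freqNormSq ℓ / freqNormSq (fun i => (W.phase j).m i * (n : ℤ))) := fun j => div_nonneg (freqNormSq_nonneg _) (hKpos j).le
  -- reference frame, rotations, `p_j(0)`
  have h00 := hζ1 ⟨0, W.pos⟩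
  have h0k := hζ0 ⟨0, W.pos⟩
  have hp0 : ∀ j, pf j 0 = ((Real.sqrt ((fun i => ((ℓ i : ℤ) : ℝ)) ⬝ᵥ (fun i => ((ℓ i : ℤ) : ℝ))))⁻¹ • (fun i => ((ℓ i : ℤ) : ℝ))) ⨯₃ ζr j := by
    intro j
    rw [hp j 0, LinearMap.map_smul, LinearMap.smul_apply]
    simp only [zero_smul, add_zero]
  have hrot : ∀ j, (ζr ⟨0, W.pos⟩ ⬝ᵥ ζr j) ^ 2 + ((((Real.sqrt ((fun i => ((ℓ i : ℤ) : ℝ)) ⬝ᵥ (fun i => ((ℓ i : ℤ) : ℝ))))⁻¹ • (fun i => ((ℓ i : ℤ) : ℝ))) ⨯₃ ζr ⟨0, W.pos⟩) ⬝ᵥ ζr j) ^ 2 = 1 := fun j =>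
    (frame_bridge_inner hℓ h00 h0k (hζ1 j) (hζ0 j) 0).2.2
  -- the transport coefficients
  obtain ⟨c₁₁, c₁₂, c₂₁, c₂₂, hC0, hCsucc⟩ := comoving_cseq_exists
    (fun j : Fin k₀ => (ζr ⟨0, W.pos⟩ ⬝ᵥ ζr j) ^ 2 * Real.exp (Λ j * ((freqNormSq ℓ / freqNormSq (fun i => (W.phase j).m i * (n : ℤ))) * (W.phase j).τ + σo j * g₁ j ^ 2 * ((W.phase j).τ * (1 - 4 * W.ramp / 3)))) + ((((Real.sqrt ((fun i => ((ℓ i : ℤ) : ℝ)) ⬝ᵥ (fun i => ((ℓ i : ℤ) : ℝ))))⁻¹ • (fun i => ((ℓ i : ℤ) : ℝ))) ⨯₃ ζr ⟨0, W.pos⟩) ⬝ᵥ ζr j) ^ 2 * Real.exp (Λ j * ((freqNormSq ℓ / freqNormSq (fun i => (W.phase j).m i * (n : ℤ))) * (W.phase j).τ + σi j * g₁ j ^ 2 * ((W.phase j).τ * (1 - 4 * W.ramp / 3)))))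
    (fun j : Fin k₀ => (ζr ⟨0, W.pos⟩ ⬝ᵥ ζr j) * ((((Real.sqrt ((fun i => ((ℓ i : ℤ) : ℝ)) ⬝ᵥ (fun i => ((ℓ i : ℤ) : ℝ))))⁻¹ • (fun i => ((ℓ i : ℤ) : ℝ))) ⨯₃ ζr ⟨0, W.pos⟩) ⬝ᵥ ζr j) * (Real.exp (Λ j * ((freqNormSq ℓ / freqNormSq (fun i => (W.phase j).m i * (n : ℤ))) * (W.phase j).τ + σo j * g₁ j ^ 2 * ((W.phase j).τ * (1 - 4 * W.ramp / 3)))) - Real.exp (Λ j * ((freqNormSq ℓ / freqNormSq (fun i => (W.phase j).m i * (n : ℤ))) * (W.phase j).τ + σi j * g₁ j ^ 2 * ((W.phase j).τ * (1 - 4 * W.ramp / 3))))))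
    (fun j : Fin k₀ => ((((Real.sqrt ((fun i => ((ℓ i : ℤ) : ℝ)) ⬝ᵥ (fun i => ((ℓ i : ℤ) : ℝ))))⁻¹ • (fun i => ((ℓ i : ℤ) : ℝ))) ⨯₃ ζr ⟨0, W.pos⟩) ⬝ᵥ ζr j) ^ 2 * Real.exp (Λ j * ((freqNormSq ℓ / freqNormSq (fun i => (W.phase j).m i * (n : ℤ))) * (W.phase j).τ + σo j * g₁ j ^ 2 * ((W.phase j).τ * (1 - 4 * W.ramp / 3)))) + (ζr ⟨0, W.pos⟩ ⬝ᵥ ζr j) ^ 2 * Real.exp (Λ j * ((freqNormSq ℓ / freqNormSq (fun i => (W.phase j).m i * (n : ℤ))) * (W.phase j).τ + σi j * g₁ j ^ 2 * ((W.phase j).τ * (1 - 4 * W.ramp / 3)))))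
  have hCexp := comoving_expansive W Λ (fun j => (freqNormSq ℓ / freqNormSq (fun i => (W.phase j).m i * (n : ℤ)))) σo σi g₁ (fun j => (ζr ⟨0, W.pos⟩ ⬝ᵥ ζr j)) (fun j => ((((Real.sqrt ((fun i => ((ℓ i : ℤ) : ℝ)) ⬝ᵥ (fun i => ((ℓ i : ℤ) : ℝ))))⁻¹ • (fun i => ((ℓ i : ℤ) : ℝ))) ⨯₃ ζr ⟨0, W.pos⟩) ⬝ᵥ ζr j)) c₁₁ c₁₂ c₂₁ c₂₂
    hΛ0 hd00 hσo0 hσi0 hrot hC0 hCsucc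
  have hCbdd := comoving_bounded_total W Λ (fun j => (freqNormSq ℓ / freqNormSq (fun i => (W.phase j).m i * (n : ℤ)))) σo σi g₁ (fun j => (ζr ⟨0, W.pos⟩ ⬝ᵥ ζr j)) (fun j => ((((Real.sqrt ((fun i => ((ℓ i : ℤ) : ℝ)) ⬝ᵥ (fun i => ((ℓ i : ℤ) : ℝ))))⁻¹ • (fun i => ((ℓ i : ℤ) : ℝ))) ⨯₃ ζr ⟨0, W.pos⟩) ⬝ᵥ ζr j)) c₁₁ c₁₂ c₂₁ c₂₂
    hΛ0 hd00 hσo0 hσi0 hrot hC0 hCsucc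
  -- END
  have hEND : ∀ z₁ z₂ : ℝ, Real.exp (2 * lam * W.period) * (z₁ ^ 2 + z₂ ^ 2) ≤
      (c₁₁ k₀ * z₁ + c₁₂ k₀ * z₂) ^ 2 + (c₂₁ k₀ * z₁ + c₂₂ k₀ * z₂) ^ 2 := by
    intro z₁ z₂
    have h := comoving_transport_lower W Λ (fun j => (freqNormSq ℓ / freqNormSq (fun i => (W.phase j).m i * (n : ℤ)))) σo σi g₁ (fun j => (ζr ⟨0, W.pos⟩ ⬝ᵥ ζr j)) (fun j => ((((Real.sqrt ((fun i => ((ℓ i : ℤ) : ℝ)) ⬝ᵥ (fun i => ((ℓ i : ℤ) : ℝ))))⁻¹ • (fun i => ((ℓ i : ℤ) : ℝ))) ⨯₃ ζr ⟨0, W.pos⟩) ⬝ᵥ ζr j)) c₁₁ c₁₂ c₂₁ c₂₂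
      hΛ0 hd00 hσo0 hσi0 hrot hC0 hCsucc μ hiso hsmallX hpos z₁ z₂
    have hz : 0 ≤ z₁ ^ 2 + z₂ ^ 2 := by positivity
    exact le_trans (mul_le_mul_of_nonneg_right hlamμ hz) h
  -- the slot factors
  have hΘle : ∀ j, Real.exp (-(2 * (1 - 2 * ε) * (lam * (W.phase j).τ))) ≤ 1 := fun j => by
    rw [Real.exp_le_one_iff]
    have := (W.phase j).τ_pos
    have : 0 ≤ (1 - 2 * ε) * (lam * (W.phase j).τ) := mul_nonneg (by linarith) (by positivity)
    linarith
  have hΘprod : ∏ j, Real.exp (-(2 * (1 - 2 * ε) * (lam * (W.phase j).τ))) =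
      Real.exp (-(2 * (1 - 2 * ε) * lam * W.period)) := by
    rw [← Real.exp_sum]
    congr 1
    have e : ∑ j, -(2 * (1 - 2 * ε) * (lam * (W.phase j).τ)) = -(2 * (1 - 2 * ε) * lam) * ∑ j, (W.phase j).τ := by
      rw [Finset.mul_sum]
      exact Finset.sum_congr rfl (fun j _ => by ring)
    rw [e, show (∑ j, (W.phase j).τ) = W.period from rfl]
    ring
  have hdec := isoSector_decay_ae W hn hκ ℓ hℓn hw₀ hdiv hmean hsupp hk hdisj ζr hζ1 hζ0 hζK pf hp hs Λ σo σi σ g₁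
    (fun j => Real.exp (-(2 * (1 - 2 * ε) * (lam * (W.phase j).τ)))) Δ ε β lam
    (Real.exp (4 * (∑ j : Fin k₀, ((Λ j * ((freqNormSq ℓ / freqNormSq (fun i => (W.phase j).m i * (n : ℤ))) * (W.phase j).τ + σo j * g₁ j ^ 2 * ((W.phase j).τ * (1 - 4 * W.ramp / 3)))) + (Λ j * ((freqNormSq ℓ / freqNormSq (fun i => (W.phase j).m i * (n : ℤ))) * (W.phase j).τ + σi j * g₁ j ^ 2 * ((W.phase j).τ * (1 - 4 * W.ramp / 3)))))))) (Real.exp (-(2 * lam * W.period)))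
    (fun q j t => Real.exp (-(2 * lam * (t - (q : ℝ) * W.period)) + 2 * (Λ j * ((freqNormSq ℓ / freqNormSq (fun i => (W.phase j).m i * (n : ℤ))) * (t - ((q : ℝ) * W.period + W.start j)) + σo j * g₁ j ^ 2 * (∫ s in (0:ℝ)..(t - ((q : ℝ) * W.period + W.start j)), LatticeWord.trapezoid 0 (W.phase j).τ W.ramp s ^ 2)))) * ((c₁₁ j * (ζr ⟨0, W.pos⟩ ⬝ᵥ ζr j) + c₁₂ j * ((((Real.sqrt ((fun i => ((ℓ i : ℤ) : ℝ)) ⬝ᵥ (fun i => ((ℓ i : ℤ) : ℝ))))⁻¹ • (fun i => ((ℓ i : ℤ) : ℝ))) ⨯₃ ζr ⟨0, W.pos⟩) ⬝ᵥ ζr j)) ^ 2 + (c₂₁ j * (ζr ⟨0, W.pos⟩ ⬝ᵥ ζr j) + c₂₂ j * ((((Real.sqrt ((fun i => ((ℓ i : ℤ) : ℝ)) ⬝ᵥ (fun i => ((ℓ i : ℤ) : ℝ))))⁻¹ • (fun i => ((ℓ i : ℤ) : ℝ))) ⨯₃ ζr ⟨0, W.pos⟩) ⬝ᵥ ζr j))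 ^ 2))
    (fun q j t => Real.exp (-(2 * lam * (t - (q : ℝ) * W.period)) + 2 * (Λ j * ((freqNormSq ℓ / freqNormSq (fun i => (W.phase j).m i * (n : ℤ))) * (t - ((q : ℝ) * W.period + W.start j)) + σi j * g₁ j ^ 2 * (∫ s in (0:ℝ)..(t - ((q : ℝ) * W.period + W.start j)), LatticeWord.trapezoid 0 (W.phase j).τ W.ramp s ^ 2)))) * ((-(c₁₁ j * ((((Real.sqrt ((fun i => ((ℓ i : ℤ) : ℝ)) ⬝ᵥ (fun i => ((ℓ i : ℤ) : ℝ))))⁻¹ • (fun i => ((ℓ i : ℤ) : ℝ))) ⨯₃ ζr ⟨0, W.pos⟩) ⬝ᵥ ζr j)) + c₁₂ j * (ζr ⟨0, W.pos⟩ ⬝ᵥ ζr j)) ^ 2 + (-(c₂₁ j * ((((Real.sqrt ((fun i => ((ℓ i : ℤ) : ℝ)) ⬝ᵥ (fun i => ((ℓ i : ℤ) : ℝ))))⁻¹ • (fun i => ((ℓ i : ℤ) : ℝ))) ⨯₃ ζr ⟨0, W.pos⟩) ⬝ᵥ ζr j)) + c₂₂ j * (ζr ⟨0, W.pos⟩ ⬝ᵥ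 ζr j)) ^ 2))
    (fun q j t => (((Real.exp (-(2 * lam * (t - (q : ℝ) * W.period)) + (Λ j * ((freqNormSq ℓ / freqNormSq (fun i => (W.phase j).m i * (n : ℤ))) * (t - ((q : ℝ) * W.period + W.start j)) + σo j * g₁ j ^ 2 * (∫ s in (0:ℝ)..(t - ((q : ℝ) * W.period + W.start j)), LatticeWord.trapezoid 0 (W.phase j).τ W.ramp s ^ 2))) + (Λ j * ((freqNormSq ℓ / freqNormSq (fun i => (W.phase j).m i * (n : ℤ))) * (t - ((q : ℝ) * W.period + W.start j)) + σi j * g₁ j ^ 2 * (∫ s in (0:ℝ)..(t - ((q : ℝ) * W.period + W.start j)), LatticeWord.trapezoid 0 (W.phase j).τ W.ramp s ^ 2)))) * ((c₁₁ j * (ζr ⟨0, W.pos⟩ ⬝ᵥ ζr j) + c₁₂ j * ((((Real.sqrt ((fun i => ((ℓ i : ℤ) : ℝ)) ⬝ᵥ (fun i => ((ℓ i : ℤ) : ℝ))))⁻¹ • (fun i => ((ℓ i : ℤ) : ℝ))) ⨯₃ ζr ⟨0, W.pos⟩) ⬝ᵥ ζr j)) * (-(c₁₁ j * ((((Real.sqrt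 ((fun i => ((ℓ i : ℤ) : ℝ)) ⬝ᵥ (fun i => ((ℓ i : ℤ) : ℝ))))⁻¹ • (fun i => ((ℓ i : ℤ) : ℝ))) ⨯₃ ζr ⟨0, W.pos⟩) ⬝ᵥ ζr j)) + c₁₂ j * (ζr ⟨0, W.pos⟩ ⬝ᵥ ζr j)) + (c₂₁ j * (ζr ⟨0, W.pos⟩ ⬝ᵥ ζr j) + c₂₂ j * ((((Real.sqrt ((fun i => ((ℓ i : ℤ) : ℝ)) ⬝ᵥ (fun i => ((ℓ i : ℤ) : ℝ))))⁻¹ • (fun i => ((ℓ i : ℤ) : ℝ))) ⨯₃ ζr ⟨0, W.pos⟩) ⬝ᵥ ζr j)) * (-(c₂₁ j * ((((Real.sqrt ((fun i => ((ℓ i : ℤ) : ℝ)) ⬝ᵥ (fun i => ((ℓ i : ℤ) : ℝ))))⁻¹ • (fun i => ((ℓ i : ℤ) : ℝ))) ⨯₃ ζr ⟨0, W.pos⟩) ⬝ᵥ ζr j)) + c₂₂ j * (ζr ⟨0, W.pos⟩ ⬝ᵥ ζr j)))) : ℝ) : ℂ))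
    hΛ hΔ0 hε hβ hlam (Real.exp_pos _) hgap hσo hσi hg₁ hσole hσile
    (comoving_hGmax W Λ (fun j => (freqNormSq ℓ / freqNormSq (fun i => (W.phase j).m i * (n : ℤ)))) σo σi g₁ (fun j => (ζr ⟨0, W.pos⟩ ⬝ᵥ ζr j)) (fun j => ((((Real.sqrt ((fun i => ((ℓ i : ℤ) : ℝ)) ⬝ᵥ (fun i => ((ℓ i : ℤ) : ℝ))))⁻¹ • (fun i => ((ℓ i : ℤ) : ℝ))) ⨯₃ ζr ⟨0, W.pos⟩) ⬝ᵥ ζr j)) lam c₁₁ c₁₂ c₂₁ c₂₂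
      hΛ0 hd00 hσo0 hσi0 hlam hrot hCbdd)
    (comoving_hG W Λ (fun j => (freqNormSq ℓ / freqNormSq (fun i => (W.phase j).m i * (n : ℤ)))) σo σi g₁ (fun j => (ζr ⟨0, W.pos⟩ ⬝ᵥ ζr j)) (fun j => ((((Real.sqrt ((fun i => ((ℓ i : ℤ) : ℝ)) ⬝ᵥ (fun i => ((ℓ i : ℤ) : ℝ))))⁻¹ • (fun i => ((ℓ i : ℤ) : ℝ))) ⨯₃ ζr ⟨0, W.pos⟩) ⬝ᵥ ζr j)) lam c₁₁ c₁₂ c₂₁ c₂₂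
      hΛ0 hd00 hσo0 hσi0 hlam hrot (fun j => hCexp j (le_of_lt j.isLt)))
    hβ' hsmall
    (comoving_hwa W Λ (fun j => (freqNormSq ℓ / freqNormSq (fun i => (W.phase j).m i * (n : ℤ)))) σo g₁ (fun j => (ζr ⟨0, W.pos⟩ ⬝ᵥ ζr j)) (fun j => ((((Real.sqrt ((fun i => ((ℓ i : ℤ) : ℝ)) ⬝ᵥ (fun i => ((ℓ i : ℤ) : ℝ))))⁻¹ • (fun i => ((ℓ i : ℤ) : ℝ))) ⨯₃ ζr ⟨0, W.pos⟩) ⬝ᵥ ζr j)) lam c₁₁ c₁₂ c₂₁ c₂₂)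
    (comoving_hwb W Λ (fun j => (freqNormSq ℓ / freqNormSq (fun i => (W.phase j).m i * (n : ℤ)))) σi g₁ (fun j => (ζr ⟨0, W.pos⟩ ⬝ᵥ ζr j)) (fun j => ((((Real.sqrt ((fun i => ((ℓ i : ℤ) : ℝ)) ⬝ᵥ (fun i => ((ℓ i : ℤ) : ℝ))))⁻¹ • (fun i => ((ℓ i : ℤ) : ℝ))) ⨯₃ ζr ⟨0, W.pos⟩) ⬝ᵥ ζr j)) lam c₁₁ c₁₂ c₂₁ c₂₂)
    (comoving_hwc W Λ (fun j => (freqNormSq ℓ / freqNormSq (fun i => (W.phase j).m i * (n : ℤ)))) σo σi g₁ (fun j => (ζr ⟨0, W.pos⟩ ⬝ᵥ ζr j)) (fun j => ((((Real.sqrt ((fun i => ((ℓ i : ℤ) : ℝ)) ⬝ᵥ (fun i => ((ℓ i : ℤ) : ℝ))))⁻¹ • (fun i => ((ℓ i : ℤ) : ℝ))) ⨯₃ ζr ⟨0, W.pos⟩) ⬝ᵥ ζr j)) lam c₁₁ c₁₂ c₂₁ c₂₂)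
    (comoving_hjunc_frames W ℓ hℓ ζr hζ1 hζ0 pf hp0 Λ (fun j => (freqNormSq ℓ / freqNormSq (fun i => (W.phase j).m i * (n : ℤ)))) σo σi g₁ (fun j => (ζr ⟨0, W.pos⟩ ⬝ᵥ ζr j)) (fun j => ((((Real.sqrt ((fun i => ((ℓ i : ℤ) : ℝ)) ⬝ᵥ (fun i => ((ℓ i : ℤ) : ℝ))))⁻¹ • (fun i => ((ℓ i : ℤ) : ℝ))) ⨯₃ ζr ⟨0, W.pos⟩) ⬝ᵥ ζr j)) lam
      c₁₁ c₁₂ c₂₁ c₂₂ (fun j => rfl) (fun j => rfl) hCsucc _ _ _ (fun q j t => rfl) (fun q j t => rfl) (fun q j t => rfl))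
    (comoving_hstart_frames W ℓ hℓ ζr hζ1 hζ0 pf hp0 Λ (fun j => (freqNormSq ℓ / freqNormSq (fun i => (W.phase j).m i * (n : ℤ)))) σo σi g₁ (fun j => (ζr ⟨0, W.pos⟩ ⬝ᵥ ζr j)) (fun j => ((((Real.sqrt ((fun i => ((ℓ i : ℤ) : ℝ)) ⬝ᵥ (fun i => ((ℓ i : ℤ) : ℝ))))⁻¹ • (fun i => ((ℓ i : ℤ) : ℝ))) ⨯₃ ζr ⟨0, W.pos⟩) ⬝ᵥ ζr j)) lam
      c₁₁ c₁₂ c₂₁ c₂₂ (fun j => rfl) (fun j => rfl) hC0 _ _ _ (fun q j t => rfl) (fun q j t => rfl) (fun q j t => rfl))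
    (comoving_hend_frames W ℓ hℓ ζr hζ1 hζ0 pf hp0 Λ (fun j => (freqNormSq ℓ / freqNormSq (fun i => (W.phase j).m i * (n : ℤ)))) σo σi g₁ (fun j => (ζr ⟨0, W.pos⟩ ⬝ᵥ ζr j)) (fun j => ((((Real.sqrt ((fun i => ((ℓ i : ℤ) : ℝ)) ⬝ᵥ (fun i => ((ℓ i : ℤ) : ℝ))))⁻¹ • (fun i => ((ℓ i : ℤ) : ℝ))) ⨯₃ ζr ⟨0, W.pos⟩) ⬝ᵥ ζr j)) lam
      c₁₁ c₁₂ c₂₁ c₂₂ (fun j => rfl) (fun j => rfl) hCsucc hEND _ _ _ (fun q j t => rfl) (fun q j t => rfl)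
      (fun q j t => rfl))
    (fun j => by
      have hτ := (W.phase j).τ_pos
      refine max_le (Real.exp_le_exp.2 ?_) (Real.exp_le_exp.2 ?_)
      · have := hF j
        nlinarith only [this, hτ]
      · have := hJ j
        nlinarith only [this])
    (Finset.prod_le_one (fun j _ => (Real.exp_pos _).le) (fun j _ => hΘle j))
    (Finset.prod_pos fun j _ => Real.exp_pos _) hT hw
  rw [hΘprod, log_inv_exp_neg, inv_exp_neg, mul_div_assoc, div_self hP.ne', mul_one] at hdec
  exact hdec

end Summit.AnomalousDissipation.AnomalousDissipation.Theorems.SolenoidalFractalHomogenisation.RealisedQuasiStaticCellLaw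

end
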